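import Summits.QuantumFields.YangMills.Theorems.UnitScaleTiltProp7Lane2ChartInGrid
import Summits.QuantumFields.YangMills.Theorems.UnitScaleTiltProp7Lane2SupportInChart
import HarnessLib

/-!
# Route `UnitScaleTilt`, crux K1 «MinimiserStabilityRegPr» (stmt-QuantumFields-19200) — route-R E′ (A′), LANE II «DIVERGENCE RECOVERY AT CURVED `W`» (★★OWNER RULING №23),
# (B7) [I-5]∕[I-9] (a′) FILE 6c — **THE PEELED INDEX SET: its coarse bonds sit within `D` blocks of the centre block, the layer ratio, and the record radii**
# (★p1 g19 NAMER WORD №16 (P2) «PEEL»; the three lattice side rows the [I-9] knit feeds to w1-19200 g16's `hSC` (h9(χ) certificate, bus 13:05:27Z) and to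
# ✓`Prop7TiledCubeMemberH7H8Currency.currency_h7h8_peeled`'s `hLay`∕`hRf1`∕`hRin1`).

Cell `ym3-torus` ∕ width seat `ym3-torus-px9` (gen 8, «width 9»).  THEOREMS ONLY (0 `def`, 0 `sorry`); `--supports stmt-QuantumFields-19200 --as helper`, count-neutral.
YM₃ on T³ is a ladder rung (R3), not d = 4, not the Clay problem; nothing here claims (B7), (REC), `hN06`, E′, EX or the gap.

WHAT IS PROVED (ns `…Theorems.Prop7TiledCubeMemberH7H8PeeledIndex`; Euclidean ∕ residue bookkeeping only):
* §1 ★ `cycDist_src_le_of_mem_image` — for the image set `ι(C(lo′, m′))` of ⧗`h7h8_member_peeled` (coarse bonds `⟨transl 0 q.1, q.2⟩`, `q.1, q.1 + e_{q.2} ∈ lo′ + [0, m′]^d`)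
  and any integer block vector `B` with `B − D ≤ lo′`, `lo′ + m′ ≤ B + D`: every `ĉ ∈ ι(C(lo′, m′))` has `dist(ĉ.src κ, ↑(B κ)) ≤ D` in every direction (w1's `hSC` at
  `lo′ = B′ − (2L^s − 3)`, `m′ = 4L^s − 6`, `D = 2L^s − 3`); `cycDist_tgt_le_of_mem_image` — the same for `ĉ₊ = ĉ.src.shift ĉ.dir`'s label `q.1 + e_{q.2}`.
* §2 ★ `layer_ratio_eq` — `#(box z R_f ∖ box z R_in)·(#box z R_in)⁻¹ = ((2R_f+1)^d − (2R_in+1)^d)·((2R_in+1)^d)⁻¹` (reals; `0 ≤ R_in ≤ R_f`).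
* §3 `record_radii_real` — `2R_f + 1 = (4L^s + 3)·ℓ` and `2(R_f − p·ℓ) + 1 = (4L^s + 3 − 2p)·ℓ` for the record radius `R_f = (2L^s+1)ℓ + (ℓ−1)∕2` (`ℓ = L^{K−n}` odd), cast to `ℝ`.
* §4 ★ `exists_mem_peeledBox_of_dist_lt` — the (B6-LOC) transition set `dist(x, c) < L^s·ℓ + 2` lies in the chart image of the PEELED box `box zc (R_f − p·ℓ)` when `p ≤ L^s`
  (the `hS` of ✓`sum_le_boxSum_of_chart` at the peeled `Φt`; every centre `c`, every base chart `c₀`; record `p = 5`).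
HONEST SCOPE.  Bookkeeping; nothing of (B7)∕(REC)∕`hN06`∕the crux is asserted; rung R3, not Clay; YM gap NOT proved.

References: T. Bałaban, CMP 95 (1984) 17–40 [Balaban1984PropagatorsI] ((1.6) p.18: block labels); T. Bałaban, CMP 99 (1985) 389–434 [Balaban1985BackgroundPropagators]
((3.100) pp.413–414: localisation with collars); [folklore].
-/

set_option autoImplicit false

namespace Summit.QuantumFields.YangMills.Theorems.Prop7TiledCubeMemberH7H8PeeledIndex

open Literature.MathematicalPhysics.QuantumFieldTheory.Balaban1983to89
open Literature.MathematicalPhysics.QuantumFieldTheory.Balaban1983to89.T3ContinuumYM3Torus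
open Literature.MathematicalPhysics.QuantumFieldTheory.Balaban1983to89.B4Eq19LatticeOperators (Zd box unitVec mem_box box_mono card_box)
open B10Eq27TorusAxialLog (transl transl_apply)
open B7Prop1Explicit (e)
open Summit.QuantumFields.YangMills.Theorems.Prop7Lane2ChartInGrid (cycDist_intCast_le_natAbs)
open Summit.QuantumFields.YangMills.Theorems.Prop7Lane2SupportInChart (odd_pow_level)

variable (F : T3Family) (n K : ℕ)

/-! ## §1 The peeled coarse bonds sit within `D` blocks of the centre block -/

/-- A label in `lo′ + [0, m′]` with `B − D ≤ lo′` and `lo′ + m′ ≤ B + D` is within integer distance `D` of `B`. [folklore] -/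
theorem natAbs_sub_le_of_mem {lo' B : Zd (F.P K).d} {m' D : ℕ} (hlo : ∀ i, B i ≤ lo' i + D) (hhi : ∀ i, lo' i + m' ≤ B i + D)
    {b : Zd (F.P K).d} (hb : b ∈ Fintype.piFinset (fun i => Finset.Icc (lo' i) (lo' i + m'))) (κ : Fin (F.P K).d) :
    (b κ - B κ).natAbs ≤ D := by
  have h := Finset.mem_Icc.mp (Fintype.mem_piFinset.mp hb κ)
  have h1 := hlo κ
  have h2 := hhi κ
  omega

/-- ★ **THE PEEL CONDITION (w1-19200 g16's `hSC`)**: every coarse bond `ĉ` of the image set `ι(C(lo′, m′))` of ⧗`h7h8_member_peeled` — `ĉ = ⟨transl 0 q.1, q.2⟩` with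
`q.1, q.1 + e_{q.2} ∈ lo′ + [0, m′]^d` — has its source within coarse cyclic sup-distance `D` of the block vector `B` (read as the coarse site `κ ↦ ↑(B κ)`) whenever
`B − D ≤ lo′` and `lo′ + m′ ≤ B + D`. [cite: Balaban1985BackgroundPropagators, (3.100) p.413] -/
theorem cycDist_src_le_of_mem_image (lo' B : Zd (F.P K).d) (m' D : ℕ)
    (hlo : ∀ i, B i ≤ lo' i + D) (hhi : ∀ i, lo' i + m' ≤ B i + D) :
    ∀ chat ∈ (((Fintype.piFinset (fun i => Finset.Icc (lo' i) (lo' i + m'))) ×ˢ (Finset.univ : Finset (Fin (F.P K).d))).filter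
        (fun q => q.1 + e q.2 ∈ Fintype.piFinset (fun i => Finset.Icc (lo' i) (lo' i + m')))).image
        (fun q => (⟨transl (0 : Site (F.P K) (K - n)) q.1, q.2⟩ : PBond (F.P K) (K - n))),
      ∀ κ : Fin (F.P K).d,
        min (chat.src κ - ((B κ : ℤ) : ZMod ((F.P K).sitesPerDir (K - n)))).val
            ((((B κ : ℤ) : ZMod ((F.P K).sitesPerDir (K - n)))) - chat.src κ).val ≤ D := by
  classical
  intro chat hchat κ
  obtain ⟨q, hq, rfl⟩ := Finset.mem_image.mp hchat
  rw [Finset.mem_filter, Finset.mem_product] at hq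
  obtain ⟨⟨hq1, -⟩, -⟩ := hq
  have hsrc : (⟨transl (0 : Site (F.P K) (K - n)) q.1, q.2⟩ : PBond (F.P K) (K - n)).src κ
      = ((q.1 κ : ℤ) : ZMod ((F.P K).sitesPerDir (K - n))) := by
    show (0 : Site (F.P K) (K - n)) κ + ((q.1 κ : ℤ) : ZMod ((F.P K).sitesPerDir (K - n))) = _
    exact zero_add _
  rw [hsrc]
  exact (cycDist_intCast_le_natAbs (q.1 κ) (B κ)).trans (natAbs_sub_le_of_mem F K hlo hhi hq1 κ)

/-- **THE TARGET LABEL TOO**: under the same hypotheses the target label `q.1 + e_{q.2}` of every `ĉ ∈ ι(C(lo′, m′))` is within `D` of `B`. [folklore] -/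
theorem cycDist_tgt_le_of_mem_image (lo' B : Zd (F.P K).d) (m' D : ℕ)
    (hlo : ∀ i, B i ≤ lo' i + D) (hhi : ∀ i, lo' i + m' ≤ B i + D) :
    ∀ q ∈ ((Fintype.piFinset (fun i => Finset.Icc (lo' i) (lo' i + m'))) ×ˢ (Finset.univ : Finset (Fin (F.P K).d))).filter
        (fun q => q.1 + e q.2 ∈ Fintype.piFinset (fun i => Finset.Icc (lo' i) (lo' i + m'))),
      ∀ κ : Fin (F.P K).d,
        min ((transl (0 : Site (F.P K) (K - n)) (q.1 + e q.2)) κ - ((B κ : ℤ) : ZMod ((F.P K).sitesPerDir (K - n)))).val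
            ((((B κ : ℤ) : ZMod ((F.P K).sitesPerDir (K - n)))) - (transl (0 : Site (F.P K) (K - n)) (q.1 + e q.2)) κ).val ≤ D := by
  classical
  intro q hq κ
  rw [Finset.mem_filter, Finset.mem_product] at hq
  obtain ⟨⟨-, -⟩, hq2⟩ := hq
  have hsrc : transl (0 : Site (F.P K) (K - n)) (q.1 + e q.2) κ = (((q.1 + e q.2) κ : ℤ) : ZMod ((F.P K).sitesPerDir (K - n))) := by
    show (0 : Site (F.P K) (K - n)) κ + (((q.1 + e q.2) κ : ℤ) : ZMod ((F.P K).sitesPerDir (K - n))) = _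
    exact zero_add _
  rw [hsrc]
  exact (cycDist_intCast_le_natAbs ((q.1 + e q.2) κ) (B κ)).trans (natAbs_sub_le_of_mem F K hlo hhi hq2 κ)

/-! ## §2 The layer ratio -/

/-- ★ **THE LAYER RATIO**: for `0 ≤ R_in ≤ R_f`, `#(box z R_f ∖ box z R_in)·(#box z R_in)⁻¹ = ((2R_f+1)^d − (2R_in+1)^d)·((2R_in+1)^d)⁻¹` (the `hLay` of
✓`currency_h7h8_peeled`, `d = (F.P K).d = 3`). [folklore] -/
theorem layer_ratio_eq (z : Zd (F.P K).d) {Rf Rin : ℤ} (hRin0 : 0 ≤ Rin) (hle : Rin ≤ Rf) :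
    ((box z Rf \ box z Rin).card : ℝ) * (((box z Rin).card : ℝ))⁻¹
      = ((2 * (Rf : ℝ) + 1) ^ (F.P K).d - (2 * (Rin : ℝ) + 1) ^ (F.P K).d) * ((2 * (Rin : ℝ) + 1) ^ (F.P K).d)⁻¹ := by
  have hsub : box z Rin ⊆ box z Rf := box_mono z hle
  have hRf0 : 0 ≤ Rf := hRin0.trans hle
  have h1 : ((box z Rf \ box z Rin).card : ℝ) = ((box z Rf).card : ℝ) - ((box z Rin).card : ℝ) := by
    rw [Finset.card_sdiff_of_subset hsub, Nat.cast_sub (Finset.card_le_card hsub)]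
  rw [h1, card_box z hRf0, card_box z hRin0]
  push_cast
  ring

/-! ## §3 The record radii, cast to `ℝ` -/

/-- **THE RECORD RADII**: with `ℓ = L^{K−n}` (odd) and `R_f := (2L^s+1)ℓ + (ℓ−1)∕2` (the chart box of record, ✓`Prop7Lane2SupportInChart` §3): `2R_f + 1 = (4L^s+3)·ℓ` and, for the
peel by `p` blocks, `2(R_f − p·ℓ) + 1 = (4L^s + 3 − 2p)·ℓ` (`R_in := R_f − p·ℓ` in ✓`peeled_tiled`'s letter) — cast to `ℝ` as ✓`currency_h7h8_peeled` reads them (`hRf1`,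
`hRin1` at `p = 4`, after `norm_num`). [folklore] -/
theorem record_radii_real (s p : ℕ) :
    2 * (((2 * ((F.L ^ s : ℕ) : ℤ) + 1) * ((F.L ^ (K - n) : ℕ) : ℤ) + (((F.L ^ (K - n) : ℕ) : ℤ) - 1) / 2 : ℤ) : ℝ) + 1
        = (4 * (F.L : ℝ) ^ s + 3) * (F.L : ℝ) ^ (K - n) ∧
    2 * (((2 * ((F.L ^ s : ℕ) : ℤ) + 1) * ((F.L ^ (K - n) : ℕ) : ℤ) + (((F.L ^ (K - n) : ℕ) : ℤ) - 1) / 2 - (p : ℤ) * ((F.L ^ (K - n) : ℕ) : ℤ) : ℤ) : ℝ) + 1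
        = (4 * (F.L : ℝ) ^ s + 3 - 2 * p) * (F.L : ℝ) ^ (K - n) := by
  obtain ⟨k, hk⟩ := odd_pow_level F n K
  have hk' : ((F.L ^ (K - n) : ℕ) : ℤ) = 2 * k + 1 := by exact_mod_cast hk
  have hdiv : ((((F.L ^ (K - n) : ℕ) : ℤ) - 1) / 2) = k := by rw [hk']; omega
  have hkR : ((F.L : ℝ) ^ (K - n)) = 2 * (k : ℝ) + 1 := by exact_mod_cast hk
  rw [hdiv]
  constructor
  · push_cast
    rw [hkR]
    ring
  · push_cast
    rw [hkR]
    ring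

/-! ## §4 The (B6-LOC) transition set sits inside the peeled box (`p ≤ L^s`) -/

/-- ★ **THE TRANSITION SET IS INSIDE THE PEELED BOX** (the `hΦt : Φ_S ≤ Φt` junction of px11's (B6-LOC) socket with ✓`h7h8_member_peeled`'s left side, via
✓`Prop7TiledCubeMemberH7H8.sum_le_boxSum_of_chart`): in the base chart `c₀` of ANY centre `c` (block vector `B′ := (val c − val c₀)∕ℓ`, box centre `zc κ = ℓ·B′_κ + (ℓ−1)∕2`
as in ✓`Prop7Lane2SupportInChart.exists_mem_blockBox_of_dist_lt`), every site within cyclic sup-distance `< L^s·ℓ + 2` of `c` is `transl c₀ w` for some `w` in the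
PEELED box `box zc R_in`, `R_in + p·ℓ = R_f = (2L^s+1)ℓ + (ℓ−1)∕2` (`hRin` = ✓`peeled_tiled`'s third conjunct, `R_in := R_f − (p:ℤ)·ℓ`), provided `p ≤ L^s`: the margin is
`(L^s + 1 − p)·ℓ ≥ ℓ ≥ 1` on both sides for every residue of the centre inside its block (record `p = 5`, `s ≥ 2`).
[cite: Balaban1985BackgroundPropagators, (3.100) p.413] -/
theorem exists_mem_peeledBox_of_dist_lt (s p : ℕ) (hp : p ≤ F.L ^ s) (c₀ c x : Site (F.P K) 0) {Rin : ℤ}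
    (hRin : Rin + (p : ℤ) * ((F.L ^ (K - n) : ℕ) : ℤ) = (2 * ((F.L ^ s : ℕ) : ℤ) + 1) * ((F.L ^ (K - n) : ℕ) : ℤ) + (((F.L ^ (K - n) : ℕ) : ℤ) - 1) / 2)
    (hx : ∀ κ, min (x κ - c κ).val (c κ - x κ).val < F.L ^ s * F.L ^ (K - n) + 2) :
    ∃ w ∈ box (fun κ : Fin (F.P K).d => ((F.L ^ (K - n) : ℕ) : ℤ) *
          (((((c κ).val : ℕ) : ℤ) - (((c₀ κ).val : ℕ) : ℤ)) / ((F.L ^ (K - n) : ℕ) : ℤ)) + (((F.L ^ (K - n) : ℕ) : ℤ) - 1) / 2) Rin,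
      transl c₀ w = x := by
  have hL : 0 < F.L := by have := F.hL.2; omega
  have hℓ1 : 1 ≤ F.L ^ (K - n) := Nat.one_le_pow _ _ hL
  have hℓ1' : (1 : ℤ) ≤ ((F.L ^ (K - n) : ℕ) : ℤ) := by exact_mod_cast hℓ1
  have hℓ0 : (0 : ℤ) < ((F.L ^ (K - n) : ℕ) : ℤ) := by omega
  have hp' : (p : ℤ) ≤ ((F.L ^ s : ℕ) : ℤ) := by exact_mod_cast hp
  have hp0 : (0 : ℤ) ≤ (p : ℤ) := Int.natCast_nonneg p
  obtain ⟨k, hk⟩ := odd_pow_level F n K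
  have hk' : ((F.L ^ (K - n) : ℕ) : ℤ) = 2 * k + 1 := by exact_mod_cast hk
  -- `(R + 1 − p)·ℓ ≥ ℓ ≥ 1`: the margin that makes both box inequalities hold for every residue of the centre
  have hslack : ((F.L ^ (K - n) : ℕ) : ℤ) ≤ (((F.L ^ s : ℕ) : ℤ) + 1 - p) * ((F.L ^ (K - n) : ℕ) : ℤ) :=
    le_mul_of_one_le_left hℓ0.le (by omega)
  have hpl : 0 ≤ (p : ℤ) * ((F.L ^ (K - n) : ℕ) : ℤ) := mul_nonneg hp0 hℓ0.le
  have hD' : ((F.L ^ s * F.L ^ (K - n) + 2 : ℕ) : ℤ) = ((F.L ^ s : ℕ) : ℤ) * ((F.L ^ (K - n) : ℕ) : ℤ) + 2 := by push_cast; ring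
  have key := Prop7Lane2SupportInChart.exists_mem_box_transl_eq_recentre F K c₀ c x
    (fun κ => (((c κ).val : ℕ) : ℤ) - (((c₀ κ).val : ℕ) : ℤ)) (Prop7Lane2SupportInChart.transl_valSub_eq F K c₀ c)
    (fun κ => ((F.L ^ (K - n) : ℕ) : ℤ) * (((((c κ).val : ℕ) : ℤ) - (((c₀ κ).val : ℕ) : ℤ)) / ((F.L ^ (K - n) : ℕ) : ℤ))
        + (((F.L ^ (K - n) : ℕ) : ℤ) - 1) / 2 - ((((c κ).val : ℕ) : ℤ) - (((c₀ κ).val : ℕ) : ℤ)))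
    Rin (F.L ^ s * F.L ^ (K - n) + 2) (fun κ => ?_) (fun κ => ?_) hx
  · obtain ⟨w, hw, he⟩ := key
    refine ⟨w, ?_, he⟩
    have e : (fun κ => ((((c κ).val : ℕ) : ℤ) - (((c₀ κ).val : ℕ) : ℤ))) +
        (fun κ => ((F.L ^ (K - n) : ℕ) : ℤ) * (((((c κ).val : ℕ) : ℤ) - (((c₀ κ).val : ℕ) : ℤ)) / ((F.L ^ (K - n) : ℕ) : ℤ))
          + (((F.L ^ (K - n) : ℕ) : ℤ) - 1) / 2 - ((((c κ).val : ℕ) : ℤ) - (((c₀ κ).val : ℕ) : ℤ)))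
        = fun κ : Fin (F.P K).d => ((F.L ^ (K - n) : ℕ) : ℤ) *
          (((((c κ).val : ℕ) : ℤ) - (((c₀ κ).val : ℕ) : ℤ)) / ((F.L ^ (K - n) : ℕ) : ℤ)) + (((F.L ^ (K - n) : ℕ) : ℤ) - 1) / 2 := by
      funext κ; simp only [Pi.add_apply]; ring
    rw [e] at hw
    exact hw
  · -- lower margin: `z κ − R_in ≤ 1 − D`
    have hdiv := Int.emod_add_mul_ediv ((((c κ).val : ℕ) : ℤ) - (((c₀ κ).val : ℕ) : ℤ)) ((F.L ^ (K - n) : ℕ) : ℤ)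
    have hm0 := Int.emod_nonneg ((((c κ).val : ℕ) : ℤ) - (((c₀ κ).val : ℕ) : ℤ)) hℓ0.ne'
    have hm1 := Int.emod_lt_of_pos ((((c κ).val : ℕ) : ℤ) - (((c₀ κ).val : ℕ) : ℤ)) hℓ0
    rw [hD']
    have hRin' : Rin = 2 * (((F.L ^ s : ℕ) : ℤ) * ((F.L ^ (K - n) : ℕ) : ℤ)) + ((F.L ^ (K - n) : ℕ) : ℤ) - (p : ℤ) * ((F.L ^ (K - n) : ℕ) : ℤ)
        + (((F.L ^ (K - n) : ℕ) : ℤ) - 1) / 2 := by linear_combination hRin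
    have hsl : ((F.L ^ (K - n) : ℕ) : ℤ) ≤ ((F.L ^ s : ℕ) : ℤ) * ((F.L ^ (K - n) : ℕ) : ℤ) + ((F.L ^ (K - n) : ℕ) : ℤ) - (p : ℤ) * ((F.L ^ (K - n) : ℕ) : ℤ) := by
      linarith [hslack]
    rw [hRin']
    generalize ((F.L ^ s : ℕ) : ℤ) * ((F.L ^ (K - n) : ℕ) : ℤ) = P at hsl ⊢
    generalize (p : ℤ) * ((F.L ^ (K - n) : ℕ) : ℤ) = PL at hsl hpl ⊢
    generalize ((F.L ^ (K - n) : ℕ) : ℤ) * (((((c κ).val : ℕ) : ℤ) - (((c₀ κ).val : ℕ) : ℤ)) / ((F.L ^ (K - n) : ℕ) : ℤ)) = Q at hdiv ⊢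
    omega
  · have hdiv := Int.emod_add_mul_ediv ((((c κ).val : ℕ) : ℤ) - (((c₀ κ).val : ℕ) : ℤ)) ((F.L ^ (K - n) : ℕ) : ℤ)
    have hm0 := Int.emod_nonneg ((((c κ).val : ℕ) : ℤ) - (((c₀ κ).val : ℕ) : ℤ)) hℓ0.ne'
    have hm1 := Int.emod_lt_of_pos ((((c κ).val : ℕ) : ℤ) - (((c₀ κ).val : ℕ) : ℤ)) hℓ0
    rw [hD']
    have hRin' : Rin = 2 * (((F.L ^ s : ℕ) : ℤ) * ((F.L ^ (K - n) : ℕ) : ℤ)) + ((F.L ^ (K - n) : ℕ) : ℤ) - (p : ℤ) * ((F.L ^ (K - n) : ℕ) : ℤ)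
        + (((F.L ^ (K - n) : ℕ) : ℤ) - 1) / 2 := by linear_combination hRin
    have hsl : ((F.L ^ (K - n) : ℕ) : ℤ) ≤ ((F.L ^ s : ℕ) : ℤ) * ((F.L ^ (K - n) : ℕ) : ℤ) + ((F.L ^ (K - n) : ℕ) : ℤ) - (p : ℤ) * ((F.L ^ (K - n) : ℕ) : ℤ) := by
      linarith [hslack]
    rw [hRin']
    generalize ((F.L ^ s : ℕ) : ℤ) * ((F.L ^ (K - n) : ℕ) : ℤ) = P at hsl ⊢
    generalize (p : ℤ) * ((F.L ^ (K - n) : ℕ) : ℤ) = PL at hsl hpl ⊢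
    generalize ((F.L ^ (K - n) : ℕ) : ℤ) * (((((c κ).val : ℕ) : ℤ) - (((c₀ κ).val : ℕ) : ℤ)) / ((F.L ^ (K - n) : ℕ) : ℤ)) = Q at hdiv ⊢
    omega

end Summit.QuantumFields.YangMills.Theorems.Prop7TiledCubeMemberH7H8PeeledIndex
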